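import Summits.QuantumFields.YangMills.Theorems.AllWindowsColdBoxKernelConvolution

/-!
# Skin convolutions without logarithms (for the (J′4) block-inverse assembly of STUB-PLAN-U1 rev 3 §7.4; LINE-19/20 S3b–U1, LINE-18 K1)

Convolution counts over a finite index set `S` (the skin) seen from two EXTERNAL points through distance functions `δ₁ = d(x,·)`, `δ₂ = d(·,y)`
with `d(x,y) ≤ δ₁ + δ₂`:
* `sum_mul_le_two_region_ext` — the two-region split in this external form;
* `sum_mul_le_min_split` — `Σ_z |f z||g z| ≤ A B (Σ_z (1+δ₁ z)^{−(a+b)} + Σ_z (1+δ₂ z)^{−(a+b)})` (compare `δ₁ z` with `δ₂ z` pointwise);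
* `sum_inv_rpow_le_of_growth_ext` — external-centre row sums `Σ_z (1+δ z)^{−r} ≤ c_S 2^D (1 − 2^{D−r})⁻¹` from `#{δ ≤ ρ} ≤ c_S (1+ρ)^D`, `r > D`;
* **`conv_three_four_le`** — `Σ_z (1+δ₁ z)^{−3}(1+δ₂ z)^{−4} ≤ (8 T₄ + 32 T)·(1+d(x,y))^{−3}` given the row sums `Σ(1+δ₂)^{−4} ≤ T₄` and `Σ(1+δᵢ)^{−7/2} ≤ T`
  (NO logarithm: in the far region the exponent `4 = 7/2 + 1/2` is split and the min-split closes with `3 + 1/2 = 7/2`);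
* **`conv_three_three_le`** — `Σ_z (1+δ₁ z)^{−3}(1+δ₂ z)^{−3} ≤ 24 T·(1+d(x,y))^{−5/2}` given `Σ(1+δᵢ)^{−7/2} ≤ T` (same trick, `3 = 5/2 + 1/2`).
On a `3`-dimensional skin `T₄, T < ∞` uniformly (`7/2 > 3`), so the block-inverse counts of (J′4) close at `(1+d)^{−3}` and `(1+d)^{−5/2} ≤ (1+d)^{−2}` WITHOUT the
`log H` that the crude count produces.  Mathlib-only; no definitions; standard axioms.

HONEST LABEL: helper lemmas toward the OPEN stubs S3b/U1 (⟨stmt-QuantumFields-24004⟩, ⟨24336⟩) and K1 (⟨24006⟩); no stub, crux, rung or summit is proved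
here; the Yang–Mills mass gap is NOT proved by this file.
-/

set_option autoImplicit false

open Finset

namespace Summit.QuantumFields.YangMills.Theorems.AllWindowsColdBox.Jaffard

variable {S : Type*} [Fintype S]

/-- **Two-region split, external form.**  `δ₁ z = d(x,z)`, `δ₂ z = d(z,y)` with `d(x,y) ≤ δ₁ z + δ₂ z`: if `|f z|(1+δ₁ z)^a ≤ A` and
`|g z|(1+δ₂ z)^b ≤ B` then `Σ_z |f z||g z| ≤ 2^a A (1+d(x,y))^{−a} Σ|g| + 2^b B (1+d(x,y))^{−b} Σ|f|`. -/
theorem sum_mul_le_two_region_ext (δ₁ δ₂ : S → ℝ) (Dxy : ℝ) {a b : ℝ} (ha : 0 ≤ a) (hb : 0 ≤ b)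
    (hD : 0 ≤ Dxy) (htri : ∀ z, Dxy ≤ δ₁ z + δ₂ z)
    {f g : S → ℝ} {A B : ℝ} (hA : 0 ≤ A) (hB : 0 ≤ B)
    (hf : ∀ z, |f z| * (1 + δ₁ z) ^ a ≤ A) (hg : ∀ z, |g z| * (1 + δ₂ z) ^ b ≤ B) :
    ∑ z, |f z| * |g z| ≤ 2 ^ a * A * ((1 + Dxy) ^ a)⁻¹ * ∑ z, |g z| + 2 ^ b * B * ((1 + Dxy) ^ b)⁻¹ * ∑ z, |f z| := by
  have hwa : 0 < (1 + Dxy) ^ a := Real.rpow_pos_of_pos (by linarith) a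
  have hwb : 0 < (1 + Dxy) ^ b := Real.rpow_pos_of_pos (by linarith) b
  set R₁ : Finset S := Finset.univ.filter (fun z => Dxy ≤ 2 * δ₁ z) with hR₁
  have key1 : ∀ z ∈ R₁, |f z| ≤ 2 ^ a * A * ((1 + Dxy) ^ a)⁻¹ := by
    intro z hz
    have hz' : Dxy ≤ 2 * δ₁ z := (Finset.mem_filter.1 hz).2
    have h1 : (1 + Dxy) ^ a ≤ (2 * (1 + δ₁ z)) ^ a := Real.rpow_le_rpow (by linarith) (by linarith) ha
    rw [Real.mul_rpow (by norm_num) (by linarith)] at h1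
    rw [← div_eq_mul_inv, le_div_iff₀ hwa]
    calc |f z| * (1 + Dxy) ^ a ≤ |f z| * (2 ^ a * (1 + δ₁ z) ^ a) := mul_le_mul_of_nonneg_left h1 (abs_nonneg _)
      _ = 2 ^ a * (|f z| * (1 + δ₁ z) ^ a) := by ring
      _ ≤ 2 ^ a * A := mul_le_mul_of_nonneg_left (hf z) (Real.rpow_nonneg (by norm_num) a)
  have key2 : ∀ z ∈ Finset.univ.filter (fun z => ¬ Dxy ≤ 2 * δ₁ z), |g z| ≤ 2 ^ b * B * ((1 + Dxy) ^ b)⁻¹ := by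
    intro z hz
    have hz' : ¬ Dxy ≤ 2 * δ₁ z := (Finset.mem_filter.1 hz).2
    have hz'' : Dxy ≤ 2 * δ₂ z := by have := htri z; have := not_le.1 hz'; linarith
    have h1 : (1 + Dxy) ^ b ≤ (2 * (1 + δ₂ z)) ^ b := Real.rpow_le_rpow (by linarith) (by linarith) hb
    rw [Real.mul_rpow (by norm_num) (by linarith)] at h1
    rw [← div_eq_mul_inv, le_div_iff₀ hwb]
    calc |g z| * (1 + Dxy) ^ b ≤ |g z| * (2 ^ b * (1 + δ₂ z) ^ b) := mul_le_mul_of_nonneg_left h1 (abs_nonneg _)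
      _ = 2 ^ b * (|g z| * (1 + δ₂ z) ^ b) := by ring
      _ ≤ 2 ^ b * B := mul_le_mul_of_nonneg_left (hg z) (Real.rpow_nonneg (by norm_num) b)
  have hc1 : 0 ≤ 2 ^ a * A * ((1 + Dxy) ^ a)⁻¹ := by positivity
  have hc2 : 0 ≤ 2 ^ b * B * ((1 + Dxy) ^ b)⁻¹ := by positivity
  rw [← Finset.sum_filter_add_sum_filter_not Finset.univ (fun z => Dxy ≤ 2 * δ₁ z)]
  have h1 : ∑ z ∈ R₁, |f z| * |g z| ≤ 2 ^ a * A * ((1 + Dxy) ^ a)⁻¹ * ∑ z, |g z| := by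
    calc ∑ z ∈ R₁, |f z| * |g z| ≤ ∑ z ∈ R₁, 2 ^ a * A * ((1 + Dxy) ^ a)⁻¹ * |g z| :=
          Finset.sum_le_sum fun z hz => mul_le_mul_of_nonneg_right (key1 z hz) (abs_nonneg _)
      _ = 2 ^ a * A * ((1 + Dxy) ^ a)⁻¹ * ∑ z ∈ R₁, |g z| := by rw [Finset.mul_sum]
      _ ≤ 2 ^ a * A * ((1 + Dxy) ^ a)⁻¹ * ∑ z, |g z| :=
          mul_le_mul_of_nonneg_left (Finset.sum_le_sum_of_subset_of_nonneg (Finset.subset_univ _) fun z _ _ => abs_nonneg _) hc1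
  have h2 : ∑ z ∈ Finset.univ.filter (fun z => ¬ Dxy ≤ 2 * δ₁ z), |f z| * |g z| ≤ 2 ^ b * B * ((1 + Dxy) ^ b)⁻¹ * ∑ z, |f z| := by
    calc ∑ z ∈ Finset.univ.filter (fun z => ¬ Dxy ≤ 2 * δ₁ z), |f z| * |g z|
          ≤ ∑ z ∈ Finset.univ.filter (fun z => ¬ Dxy ≤ 2 * δ₁ z), |f z| * (2 ^ b * B * ((1 + Dxy) ^ b)⁻¹) :=
          Finset.sum_le_sum fun z hz => mul_le_mul_of_nonneg_left (key2 z hz) (abs_nonneg _)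
      _ = 2 ^ b * B * ((1 + Dxy) ^ b)⁻¹ * ∑ z ∈ Finset.univ.filter (fun z => ¬ Dxy ≤ 2 * δ₁ z), |f z| := by
          rw [Finset.mul_sum]; exact Finset.sum_congr rfl fun z _ => by ring
      _ ≤ 2 ^ b * B * ((1 + Dxy) ^ b)⁻¹ * ∑ z, |f z| :=
          mul_le_mul_of_nonneg_left (Finset.sum_le_sum_of_subset_of_nonneg (Finset.subset_univ _) fun z _ _ => abs_nonneg _) hc2
  exact add_le_add h1 h2

/-- **Min split.**  `|f z|(1+δ₁ z)^a ≤ A`, `|g z|(1+δ₂ z)^b ≤ B` ⇒ `Σ_z |f z||g z| ≤ A B (Σ_z (1+δ₁ z)^{−(a+b)} + Σ_z (1+δ₂ z)^{−(a+b)})`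
(at each `z` the larger of `δ₁ z, δ₂ z` absorbs both exponents). -/
theorem sum_mul_le_min_split (δ₁ δ₂ : S → ℝ) {a b : ℝ} (ha : 0 ≤ a) (hb : 0 ≤ b)
    (hδ₁ : ∀ z, 0 ≤ δ₁ z) (hδ₂ : ∀ z, 0 ≤ δ₂ z) {f g : S → ℝ} {A B : ℝ} (hA : 0 ≤ A) (hB : 0 ≤ B)
    (hf : ∀ z, |f z| * (1 + δ₁ z) ^ a ≤ A) (hg : ∀ z, |g z| * (1 + δ₂ z) ^ b ≤ B) :
    ∑ z, |f z| * |g z| ≤ A * B * (∑ z, ((1 + δ₁ z) ^ (a + b))⁻¹ + ∑ z, ((1 + δ₂ z) ^ (a + b))⁻¹) := by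
  rw [mul_add, Finset.mul_sum, Finset.mul_sum, ← Finset.sum_add_distrib]
  refine Finset.sum_le_sum fun z _ => ?_
  have h1 : 0 < 1 + δ₁ z := by linarith [hδ₁ z]
  have h2 : 0 < 1 + δ₂ z := by linarith [hδ₂ z]
  have hfa : |f z| ≤ A * ((1 + δ₁ z) ^ a)⁻¹ := by
    rw [← div_eq_mul_inv, le_div_iff₀ (Real.rpow_pos_of_pos h1 a)]; exact hf z
  have hgb : |g z| ≤ B * ((1 + δ₂ z) ^ b)⁻¹ := by
    rw [← div_eq_mul_inv, le_div_iff₀ (Real.rpow_pos_of_pos h2 b)]; exact hg z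
  have hprod : |f z| * |g z| ≤ A * B * (((1 + δ₁ z) ^ a)⁻¹ * ((1 + δ₂ z) ^ b)⁻¹) := by
    calc |f z| * |g z| ≤ (A * ((1 + δ₁ z) ^ a)⁻¹) * (B * ((1 + δ₂ z) ^ b)⁻¹) :=
          mul_le_mul hfa hgb (abs_nonneg _) (by positivity)
      _ = A * B * (((1 + δ₁ z) ^ a)⁻¹ * ((1 + δ₂ z) ^ b)⁻¹) := by ring
  refine hprod.trans ?_
  have hAB : 0 ≤ A * B := mul_nonneg hA hB
  have hT1 : 0 ≤ ((1 + δ₁ z) ^ (a + b))⁻¹ := by positivity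
  have hT2 : 0 ≤ ((1 + δ₂ z) ^ (a + b))⁻¹ := by positivity
  rw [Real.rpow_add h1, Real.rpow_add h2, mul_inv, mul_inv]
  rcases le_total (δ₁ z) (δ₂ z) with hle | hle
  · -- `(1+δ₂)^{-b} ≤ (1+δ₁)^{-b}`
    have hb' : ((1 + δ₂ z) ^ b)⁻¹ ≤ ((1 + δ₁ z) ^ b)⁻¹ :=
      inv_anti₀ (Real.rpow_pos_of_pos h1 b) (Real.rpow_le_rpow h1.le (by linarith) hb)
    calc A * B * (((1 + δ₁ z) ^ a)⁻¹ * ((1 + δ₂ z) ^ b)⁻¹) ≤ A * B * (((1 + δ₁ z) ^ a)⁻¹ * ((1 + δ₁ z) ^ b)⁻¹) :=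
          mul_le_mul_of_nonneg_left (mul_le_mul_of_nonneg_left hb' (by positivity)) hAB
      _ ≤ A * B * (((1 + δ₁ z) ^ a)⁻¹ * ((1 + δ₁ z) ^ b)⁻¹) + A * B * (((1 + δ₂ z) ^ a)⁻¹ * ((1 + δ₂ z) ^ b)⁻¹) := by
          have : 0 ≤ A * B * (((1 + δ₂ z) ^ a)⁻¹ * ((1 + δ₂ z) ^ b)⁻¹) := by positivity
          linarith
  · have ha' : ((1 + δ₁ z) ^ a)⁻¹ ≤ ((1 + δ₂ z) ^ a)⁻¹ :=
      inv_anti₀ (Real.rpow_pos_of_pos h2 a) (Real.rpow_le_rpow h2.le (by linarith) ha)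
    calc A * B * (((1 + δ₁ z) ^ a)⁻¹ * ((1 + δ₂ z) ^ b)⁻¹) ≤ A * B * (((1 + δ₂ z) ^ a)⁻¹ * ((1 + δ₂ z) ^ b)⁻¹) :=
          mul_le_mul_of_nonneg_left (mul_le_mul_of_nonneg_right ha' (by positivity)) hAB
      _ ≤ A * B * (((1 + δ₁ z) ^ a)⁻¹ * ((1 + δ₁ z) ^ b)⁻¹) + A * B * (((1 + δ₂ z) ^ a)⁻¹ * ((1 + δ₂ z) ^ b)⁻¹) := by
          have : 0 ≤ A * B * (((1 + δ₁ z) ^ a)⁻¹ * ((1 + δ₁ z) ^ b)⁻¹) := by positivity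
          linarith

/-- **Row sums around an external centre**: if `#{z : δ z ≤ ρ} ≤ c_S (1+ρ)^D` for all `ρ ≥ 0` (`δ ≥ 0`) and `0 ≤ D < r`, then
`Σ_z (1+δ z)^{−r} ≤ c_S 2^D (1 − 2^{D−r})⁻¹`. -/
theorem sum_inv_rpow_le_of_growth_ext (δ : S → ℝ) {r D cS : ℝ} (hD : 0 ≤ D) (hDr : D < r) (hcS : 0 ≤ cS)
    (hδ : ∀ z, 0 ≤ δ z)
    (hG : ∀ ρ : ℝ, 0 ≤ ρ → ((Finset.univ.filter (fun z => δ z ≤ ρ)).card : ℝ) ≤ cS * (1 + ρ) ^ D) :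
    ∑ z, ((1 + δ z) ^ r)⁻¹ ≤ cS * (2 : ℝ) ^ D * (1 - (2 : ℝ) ^ (D - r))⁻¹ := by
  rcases isEmpty_or_nonempty S with hS | ⟨⟨y⟩⟩
  · rw [Finset.univ_eq_empty, Finset.sum_empty]
    have h2 : (2 : ℝ) ^ (D - r) < 1 := Real.rpow_lt_one_of_one_lt_of_neg one_lt_two (by linarith)
    have : 0 ≤ (1 - (2 : ℝ) ^ (D - r))⁻¹ := inv_nonneg.2 (by linarith)
    positivity
  · exact sum_inv_rpow_le_of_growth (fun z _ => δ z) hD hDr hcS (fun z _ => hδ z) (fun _ ρ hρ => hG ρ hρ) y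

/-- **`(3,4)`-convolution over the skin, no logarithm**: with `d(x,y) ≤ δ₁ + δ₂`, `Σ_z (1+δ₂ z)^{−4} ≤ T₄`, `Σ_z (1+δᵢ z)^{−7/2} ≤ T` (`i = 1,2`):
`Σ_z (1+δ₁ z)^{−3} (1+δ₂ z)^{−4} ≤ (8 T₄ + 32 T) (1+d(x,y))^{−3}`. -/
theorem conv_three_four_le (δ₁ δ₂ : S → ℝ) (Dxy : ℝ) (hδ₁ : ∀ z, 0 ≤ δ₁ z) (hδ₂ : ∀ z, 0 ≤ δ₂ z) (hD : 0 ≤ Dxy)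
    (htri : ∀ z, Dxy ≤ δ₁ z + δ₂ z) {T₄ T : ℝ} (hT₄ : ∑ z, ((1 + δ₂ z) ^ (4 : ℝ))⁻¹ ≤ T₄)
    (hT1 : ∑ z, ((1 + δ₁ z) ^ (7 / 2 : ℝ))⁻¹ ≤ T) (hT2 : ∑ z, ((1 + δ₂ z) ^ (7 / 2 : ℝ))⁻¹ ≤ T) :
    ∑ z, ((1 + δ₁ z) ^ (3 : ℝ))⁻¹ * ((1 + δ₂ z) ^ (4 : ℝ))⁻¹ ≤ (8 * T₄ + 32 * T) * ((1 + Dxy) ^ (3 : ℝ))⁻¹ := by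
  have h1 : ∀ z, 0 < 1 + δ₁ z := fun z => by linarith [hδ₁ z]
  have h2 : ∀ z, 0 < 1 + δ₂ z := fun z => by linarith [hδ₂ z]
  have hxy : 0 < 1 + Dxy := by linarith
  have hp1 : ∀ (z : S) (t : ℝ), 0 ≤ ((1 + δ₁ z) ^ t)⁻¹ := fun z t => inv_nonneg.2 (Real.rpow_nonneg (h1 z).le t)
  have hp2 : ∀ (z : S) (t : ℝ), 0 ≤ ((1 + δ₂ z) ^ t)⁻¹ := fun z t => inv_nonneg.2 (Real.rpow_nonneg (h2 z).le t)
  have hT0 : 0 ≤ T := le_trans (Finset.sum_nonneg fun z _ => hp1 z _) hT1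
  have hT₄0 : 0 ≤ T₄ := le_trans (Finset.sum_nonneg fun z _ => hp2 z _) hT₄
  -- split at `Dxy ≤ 2 δ₁ z`
  set R₁ : Finset S := Finset.univ.filter (fun z => Dxy ≤ 2 * δ₁ z) with hR₁
  rw [← Finset.sum_filter_add_sum_filter_not Finset.univ (fun z => Dxy ≤ 2 * δ₁ z)]
  -- region I
  have hI : ∑ z ∈ R₁, ((1 + δ₁ z) ^ (3 : ℝ))⁻¹ * ((1 + δ₂ z) ^ (4 : ℝ))⁻¹ ≤ 8 * T₄ * ((1 + Dxy) ^ (3 : ℝ))⁻¹ := by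
    have key : ∀ z ∈ R₁, ((1 + δ₁ z) ^ (3 : ℝ))⁻¹ ≤ 8 * ((1 + Dxy) ^ (3 : ℝ))⁻¹ := by
      intro z hz
      have hz' : Dxy ≤ 2 * δ₁ z := (Finset.mem_filter.1 hz).2
      have hle : (1 + Dxy) ^ (3 : ℝ) ≤ (2 * (1 + δ₁ z)) ^ (3 : ℝ) := Real.rpow_le_rpow hxy.le (by linarith) (by norm_num)
      rw [Real.mul_rpow (by norm_num) (h1 z).le, show (2 : ℝ) ^ (3 : ℝ) = 8 by norm_num] at hle
      calc ((1 + δ₁ z) ^ (3 : ℝ))⁻¹ = 8 * (8 * (1 + δ₁ z) ^ (3 : ℝ))⁻¹ := by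
            rw [mul_inv]; field_simp
        _ ≤ 8 * ((1 + Dxy) ^ (3 : ℝ))⁻¹ := mul_le_mul_of_nonneg_left (inv_anti₀ (Real.rpow_pos_of_pos hxy _) hle) (by norm_num)
    calc ∑ z ∈ R₁, ((1 + δ₁ z) ^ (3 : ℝ))⁻¹ * ((1 + δ₂ z) ^ (4 : ℝ))⁻¹
          ≤ ∑ z ∈ R₁, 8 * ((1 + Dxy) ^ (3 : ℝ))⁻¹ * ((1 + δ₂ z) ^ (4 : ℝ))⁻¹ :=
          Finset.sum_le_sum fun z hz => mul_le_mul_of_nonneg_right (key z hz) (hp2 z _)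
      _ = 8 * ((1 + Dxy) ^ (3 : ℝ))⁻¹ * ∑ z ∈ R₁, ((1 + δ₂ z) ^ (4 : ℝ))⁻¹ := by rw [Finset.mul_sum]
      _ ≤ 8 * ((1 + Dxy) ^ (3 : ℝ))⁻¹ * T₄ := by
          refine mul_le_mul_of_nonneg_left ((Finset.sum_le_sum_of_subset_of_nonneg (Finset.subset_univ _)
            fun z _ _ => hp2 z _).trans hT₄) (by positivity)
      _ = 8 * T₄ * ((1 + Dxy) ^ (3 : ℝ))⁻¹ := by ring
  -- region II: split `4 = 7/2 + 1/2`, then the min split with `3 + 1/2 = 7/2`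
  have hII : ∑ z ∈ Finset.univ.filter (fun z => ¬ Dxy ≤ 2 * δ₁ z), ((1 + δ₁ z) ^ (3 : ℝ))⁻¹ * ((1 + δ₂ z) ^ (4 : ℝ))⁻¹ ≤
      32 * T * ((1 + Dxy) ^ (3 : ℝ))⁻¹ := by
    have key : ∀ z ∈ Finset.univ.filter (fun z => ¬ Dxy ≤ 2 * δ₁ z),
        ((1 + δ₂ z) ^ (4 : ℝ))⁻¹ ≤ 16 * ((1 + Dxy) ^ (7 / 2 : ℝ))⁻¹ * ((1 + δ₂ z) ^ (1 / 2 : ℝ))⁻¹ := by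
      intro z hz
      have hz' : ¬ Dxy ≤ 2 * δ₁ z := (Finset.mem_filter.1 hz).2
      have hz'' : Dxy ≤ 2 * δ₂ z := by have := htri z; have := not_le.1 hz'; linarith
      have hle : (1 + Dxy) ^ (7 / 2 : ℝ) ≤ (2 * (1 + δ₂ z)) ^ (7 / 2 : ℝ) := Real.rpow_le_rpow hxy.le (by linarith) (by norm_num)
      rw [Real.mul_rpow (by norm_num) (h2 z).le] at hle
      have h27 : (2 : ℝ) ^ (7 / 2 : ℝ) ≤ 16 := by
        have : (2 : ℝ) ^ (7 / 2 : ℝ) ≤ (2 : ℝ) ^ (4 : ℝ) := Real.rpow_le_rpow_of_exponent_le one_le_two (by norm_num)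
        rw [show (2 : ℝ) ^ (4 : ℝ) = 16 by norm_num] at this
        exact this
      have hsplit : ((1 + δ₂ z) ^ (4 : ℝ))⁻¹ = ((1 + δ₂ z) ^ (7 / 2 : ℝ))⁻¹ * ((1 + δ₂ z) ^ (1 / 2 : ℝ))⁻¹ := by
        rw [← mul_inv, ← Real.rpow_add (h2 z)]; norm_num
      rw [hsplit]
      refine mul_le_mul_of_nonneg_right ?_ (hp2 z _)
      calc ((1 + δ₂ z) ^ (7 / 2 : ℝ))⁻¹ ≤ ((1 + Dxy) ^ (7 / 2 : ℝ) / (2 : ℝ) ^ (7 / 2 : ℝ))⁻¹ := by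
            apply inv_anti₀ (by positivity)
            rw [div_le_iff₀ (by positivity)]; linarith
        _ = (2 : ℝ) ^ (7 / 2 : ℝ) * ((1 + Dxy) ^ (7 / 2 : ℝ))⁻¹ := by rw [inv_div, div_eq_mul_inv]
        _ ≤ 16 * ((1 + Dxy) ^ (7 / 2 : ℝ))⁻¹ := mul_le_mul_of_nonneg_right h27 (by positivity)
    have hmin := sum_mul_le_min_split δ₁ δ₂ (a := 3) (b := 1 / 2) (by norm_num) (by norm_num) hδ₁ hδ₂
      (f := fun z => ((1 + δ₁ z) ^ (3 : ℝ))⁻¹) (g := fun z => ((1 + δ₂ z) ^ (1 / 2 : ℝ))⁻¹) zero_le_one zero_le_one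
      (fun z => by rw [abs_of_pos (inv_pos.2 (Real.rpow_pos_of_pos (h1 z) _)), inv_mul_cancel₀ (Real.rpow_pos_of_pos (h1 z) _).ne'])
      (fun z => by rw [abs_of_pos (inv_pos.2 (Real.rpow_pos_of_pos (h2 z) _)), inv_mul_cancel₀ (Real.rpow_pos_of_pos (h2 z) _).ne'])
    simp only [abs_of_pos (inv_pos.2 (Real.rpow_pos_of_pos (h1 _) _)), abs_of_pos (inv_pos.2 (Real.rpow_pos_of_pos (h2 _) _)), one_mul,
      show (3 : ℝ) + 1 / 2 = 7 / 2 by norm_num] at hmin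
    have hmin' : ∑ z, ((1 + δ₁ z) ^ (3 : ℝ))⁻¹ * ((1 + δ₂ z) ^ (1 / 2 : ℝ))⁻¹ ≤ 2 * T := by linarith
    have h72 : ((1 + Dxy) ^ (7 / 2 : ℝ))⁻¹ ≤ ((1 + Dxy) ^ (3 : ℝ))⁻¹ :=
      inv_anti₀ (Real.rpow_pos_of_pos hxy _) (Real.rpow_le_rpow_of_exponent_le (by linarith) (by norm_num))
    calc ∑ z ∈ Finset.univ.filter (fun z => ¬ Dxy ≤ 2 * δ₁ z), ((1 + δ₁ z) ^ (3 : ℝ))⁻¹ * ((1 + δ₂ z) ^ (4 : ℝ))⁻¹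
          ≤ ∑ z ∈ Finset.univ.filter (fun z => ¬ Dxy ≤ 2 * δ₁ z),
            ((1 + δ₁ z) ^ (3 : ℝ))⁻¹ * (16 * ((1 + Dxy) ^ (7 / 2 : ℝ))⁻¹ * ((1 + δ₂ z) ^ (1 / 2 : ℝ))⁻¹) :=
          Finset.sum_le_sum fun z hz => mul_le_mul_of_nonneg_left (key z hz) (hp1 z _)
      _ = 16 * ((1 + Dxy) ^ (7 / 2 : ℝ))⁻¹ * ∑ z ∈ Finset.univ.filter (fun z => ¬ Dxy ≤ 2 * δ₁ z),
            ((1 + δ₁ z) ^ (3 : ℝ))⁻¹ * ((1 + δ₂ z) ^ (1 / 2 : ℝ))⁻¹ := by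
          rw [Finset.mul_sum]; exact Finset.sum_congr rfl fun z _ => by ring
      _ ≤ 16 * ((1 + Dxy) ^ (7 / 2 : ℝ))⁻¹ * (2 * T) := by
          refine mul_le_mul_of_nonneg_left ((Finset.sum_le_sum_of_subset_of_nonneg (Finset.subset_univ _)
            fun z _ _ => mul_nonneg (hp1 z _) (hp2 z _)).trans hmin') (by positivity)
      _ ≤ 16 * ((1 + Dxy) ^ (3 : ℝ))⁻¹ * (2 * T) := by gcongr
      _ = 32 * T * ((1 + Dxy) ^ (3 : ℝ))⁻¹ := by ring
  calc _ ≤ 8 * T₄ * ((1 + Dxy) ^ (3 : ℝ))⁻¹ + 32 * T * ((1 + Dxy) ^ (3 : ℝ))⁻¹ := add_le_add hI hII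
    _ = (8 * T₄ + 32 * T) * ((1 + Dxy) ^ (3 : ℝ))⁻¹ := by ring

/-- **`(3,3)`-convolution over the skin**: with `d(x,y) ≤ δ₁ + δ₂` and `Σ_z (1+δᵢ z)^{−7/2} ≤ T`:
`Σ_z (1+δ₁ z)^{−3} (1+δ₂ z)^{−3} ≤ 24 T (1+d(x,y))^{−5/2}` (split `3 = 5/2 + 1/2` on the near kernel, min split with `1/2 + 3 = 7/2`). -/
theorem conv_three_three_le (δ₁ δ₂ : S → ℝ) (Dxy : ℝ) (hδ₁ : ∀ z, 0 ≤ δ₁ z) (hδ₂ : ∀ z, 0 ≤ δ₂ z) (hD : 0 ≤ Dxy)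
    (htri : ∀ z, Dxy ≤ δ₁ z + δ₂ z) {T : ℝ}
    (hT1 : ∑ z, ((1 + δ₁ z) ^ (7 / 2 : ℝ))⁻¹ ≤ T) (hT2 : ∑ z, ((1 + δ₂ z) ^ (7 / 2 : ℝ))⁻¹ ≤ T) :
    ∑ z, ((1 + δ₁ z) ^ (3 : ℝ))⁻¹ * ((1 + δ₂ z) ^ (3 : ℝ))⁻¹ ≤ 24 * T * ((1 + Dxy) ^ (5 / 2 : ℝ))⁻¹ := by
  have h1 : ∀ z, 0 < 1 + δ₁ z := fun z => by linarith [hδ₁ z]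
  have h2 : ∀ z, 0 < 1 + δ₂ z := fun z => by linarith [hδ₂ z]
  have hxy : 0 < 1 + Dxy := by linarith
  have hp1 : ∀ (z : S) (t : ℝ), 0 ≤ ((1 + δ₁ z) ^ t)⁻¹ := fun z t => inv_nonneg.2 (Real.rpow_nonneg (h1 z).le t)
  have hp2 : ∀ (z : S) (t : ℝ), 0 ≤ ((1 + δ₂ z) ^ t)⁻¹ := fun z t => inv_nonneg.2 (Real.rpow_nonneg (h2 z).le t)
  have hT0 : 0 ≤ T := le_trans (Finset.sum_nonneg fun z _ => hp1 z _) hT1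
  have h25 : (2 : ℝ) ^ (5 / 2 : ℝ) ≤ 6 := by
    have h : ((2 : ℝ) ^ (5 / 2 : ℝ)) ^ (2 : ℕ) = 32 := by
      rw [← Real.rpow_natCast, ← Real.rpow_mul (by norm_num)]; norm_num
    nlinarith [Real.rpow_nonneg (show (0:ℝ) ≤ 2 by norm_num) (5 / 2 : ℝ)]
  -- the near-kernel bound in each region
  have near : ∀ (δ : S → ℝ) (z : S), (∀ z, 0 ≤ δ z) → Dxy ≤ 2 * δ z →
      ((1 + δ z) ^ (3 : ℝ))⁻¹ ≤ 6 * ((1 + Dxy) ^ (5 / 2 : ℝ))⁻¹ * ((1 + δ z) ^ (1 / 2 : ℝ))⁻¹ := by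
    intro δ z hδ hz
    have hδz : 0 < 1 + δ z := by linarith [hδ z]
    have hle : (1 + Dxy) ^ (5 / 2 : ℝ) ≤ (2 * (1 + δ z)) ^ (5 / 2 : ℝ) := Real.rpow_le_rpow hxy.le (by linarith) (by norm_num)
    rw [Real.mul_rpow (by norm_num) hδz.le] at hle
    have hsplit : ((1 + δ z) ^ (3 : ℝ))⁻¹ = ((1 + δ z) ^ (5 / 2 : ℝ))⁻¹ * ((1 + δ z) ^ (1 / 2 : ℝ))⁻¹ := by
      rw [← mul_inv, ← Real.rpow_add hδz]; norm_num
    rw [hsplit]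
    refine mul_le_mul_of_nonneg_right ?_ (inv_nonneg.2 (Real.rpow_nonneg hδz.le _))
    calc ((1 + δ z) ^ (5 / 2 : ℝ))⁻¹ ≤ ((1 + Dxy) ^ (5 / 2 : ℝ) / (2 : ℝ) ^ (5 / 2 : ℝ))⁻¹ := by
          apply inv_anti₀ (by positivity)
          rw [div_le_iff₀ (by positivity)]; linarith
      _ = (2 : ℝ) ^ (5 / 2 : ℝ) * ((1 + Dxy) ^ (5 / 2 : ℝ))⁻¹ := by rw [inv_div, div_eq_mul_inv]
      _ ≤ 6 * ((1 + Dxy) ^ (5 / 2 : ℝ))⁻¹ := mul_le_mul_of_nonneg_right h25 (by positivity)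
  -- the two min splits
  have hminA := sum_mul_le_min_split δ₁ δ₂ (a := 1 / 2) (b := 3) (by norm_num) (by norm_num) hδ₁ hδ₂
    (f := fun z => ((1 + δ₁ z) ^ (1 / 2 : ℝ))⁻¹) (g := fun z => ((1 + δ₂ z) ^ (3 : ℝ))⁻¹) zero_le_one zero_le_one
    (fun z => by rw [abs_of_pos (inv_pos.2 (Real.rpow_pos_of_pos (h1 z) _)), inv_mul_cancel₀ (Real.rpow_pos_of_pos (h1 z) _).ne'])
    (fun z => by rw [abs_of_pos (inv_pos.2 (Real.rpow_pos_of_pos (h2 z) _)), inv_mul_cancel₀ (Real.rpow_pos_of_pos (h2 z) _).ne'])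
  have hminB := sum_mul_le_min_split δ₁ δ₂ (a := 3) (b := 1 / 2) (by norm_num) (by norm_num) hδ₁ hδ₂
    (f := fun z => ((1 + δ₁ z) ^ (3 : ℝ))⁻¹) (g := fun z => ((1 + δ₂ z) ^ (1 / 2 : ℝ))⁻¹) zero_le_one zero_le_one
    (fun z => by rw [abs_of_pos (inv_pos.2 (Real.rpow_pos_of_pos (h1 z) _)), inv_mul_cancel₀ (Real.rpow_pos_of_pos (h1 z) _).ne'])
    (fun z => by rw [abs_of_pos (inv_pos.2 (Real.rpow_pos_of_pos (h2 z) _)), inv_mul_cancel₀ (Real.rpow_pos_of_pos (h2 z) _).ne'])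
  simp only [abs_of_pos (inv_pos.2 (Real.rpow_pos_of_pos (h1 _) _)), abs_of_pos (inv_pos.2 (Real.rpow_pos_of_pos (h2 _) _)), one_mul,
    show (1 : ℝ) / 2 + 3 = 7 / 2 by norm_num, show (3 : ℝ) + 1 / 2 = 7 / 2 by norm_num] at hminA hminB
  have hA' : ∑ z, ((1 + δ₁ z) ^ (1 / 2 : ℝ))⁻¹ * ((1 + δ₂ z) ^ (3 : ℝ))⁻¹ ≤ 2 * T := by linarith
  have hB' : ∑ z, ((1 + δ₁ z) ^ (3 : ℝ))⁻¹ * ((1 + δ₂ z) ^ (1 / 2 : ℝ))⁻¹ ≤ 2 * T := by linarith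
  set R₁ : Finset S := Finset.univ.filter (fun z => Dxy ≤ 2 * δ₁ z) with hR₁
  rw [← Finset.sum_filter_add_sum_filter_not Finset.univ (fun z => Dxy ≤ 2 * δ₁ z)]
  have hI : ∑ z ∈ R₁, ((1 + δ₁ z) ^ (3 : ℝ))⁻¹ * ((1 + δ₂ z) ^ (3 : ℝ))⁻¹ ≤ 12 * T * ((1 + Dxy) ^ (5 / 2 : ℝ))⁻¹ := by
    calc ∑ z ∈ R₁, ((1 + δ₁ z) ^ (3 : ℝ))⁻¹ * ((1 + δ₂ z) ^ (3 : ℝ))⁻¹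
          ≤ ∑ z ∈ R₁, (6 * ((1 + Dxy) ^ (5 / 2 : ℝ))⁻¹ * ((1 + δ₁ z) ^ (1 / 2 : ℝ))⁻¹) * ((1 + δ₂ z) ^ (3 : ℝ))⁻¹ :=
          Finset.sum_le_sum fun z hz => mul_le_mul_of_nonneg_right (near δ₁ z hδ₁ (Finset.mem_filter.1 hz).2) (hp2 z _)
      _ = 6 * ((1 + Dxy) ^ (5 / 2 : ℝ))⁻¹ * ∑ z ∈ R₁, ((1 + δ₁ z) ^ (1 / 2 : ℝ))⁻¹ * ((1 + δ₂ z) ^ (3 : ℝ))⁻¹ := by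
          rw [Finset.mul_sum]; exact Finset.sum_congr rfl fun z _ => by ring
      _ ≤ 6 * ((1 + Dxy) ^ (5 / 2 : ℝ))⁻¹ * (2 * T) := by
          refine mul_le_mul_of_nonneg_left ((Finset.sum_le_sum_of_subset_of_nonneg (Finset.subset_univ _)
            fun z _ _ => mul_nonneg (hp1 z _) (hp2 z _)).trans hA') (by positivity)
      _ = 12 * T * ((1 + Dxy) ^ (5 / 2 : ℝ))⁻¹ := by ring
  have hII : ∑ z ∈ Finset.univ.filter (fun z => ¬ Dxy ≤ 2 * δ₁ z), ((1 + δ₁ z) ^ (3 : ℝ))⁻¹ * ((1 + δ₂ z) ^ (3 : ℝ))⁻¹ ≤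
      12 * T * ((1 + Dxy) ^ (5 / 2 : ℝ))⁻¹ := by
    have hreg : ∀ z ∈ Finset.univ.filter (fun z => ¬ Dxy ≤ 2 * δ₁ z), Dxy ≤ 2 * δ₂ z := by
      intro z hz
      have := (Finset.mem_filter.1 hz).2
      have := htri z; have := not_le.1 (Finset.mem_filter.1 hz).2; linarith
    calc ∑ z ∈ Finset.univ.filter (fun z => ¬ Dxy ≤ 2 * δ₁ z), ((1 + δ₁ z) ^ (3 : ℝ))⁻¹ * ((1 + δ₂ z) ^ (3 : ℝ))⁻¹
          ≤ ∑ z ∈ Finset.univ.filter (fun z => ¬ Dxy ≤ 2 * δ₁ z),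
            ((1 + δ₁ z) ^ (3 : ℝ))⁻¹ * (6 * ((1 + Dxy) ^ (5 / 2 : ℝ))⁻¹ * ((1 + δ₂ z) ^ (1 / 2 : ℝ))⁻¹) :=
          Finset.sum_le_sum fun z hz => mul_le_mul_of_nonneg_left (near δ₂ z hδ₂ (hreg z hz)) (hp1 z _)
      _ = 6 * ((1 + Dxy) ^ (5 / 2 : ℝ))⁻¹ * ∑ z ∈ Finset.univ.filter (fun z => ¬ Dxy ≤ 2 * δ₁ z),
            ((1 + δ₁ z) ^ (3 : ℝ))⁻¹ * ((1 + δ₂ z) ^ (1 / 2 : ℝ))⁻¹ := by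
          rw [Finset.mul_sum]; exact Finset.sum_congr rfl fun z _ => by ring
      _ ≤ 6 * ((1 + Dxy) ^ (5 / 2 : ℝ))⁻¹ * (2 * T) := by
          refine mul_le_mul_of_nonneg_left ((Finset.sum_le_sum_of_subset_of_nonneg (Finset.subset_univ _)
            fun z _ _ => mul_nonneg (hp1 z _) (hp2 z _)).trans hB') (by positivity)
      _ = 12 * T * ((1 + Dxy) ^ (5 / 2 : ℝ))⁻¹ := by ring
  calc _ ≤ 12 * T * ((1 + Dxy) ^ (5 / 2 : ℝ))⁻¹ + 12 * T * ((1 + Dxy) ^ (5 / 2 : ℝ))⁻¹ := add_le_add hI hII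
    _ = 24 * T * ((1 + Dxy) ^ (5 / 2 : ℝ))⁻¹ := by ring

end Summit.QuantumFields.YangMills.Theorems.AllWindowsColdBox.Jaffard
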